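import Literature.NumberTheory.Sieve.GoldbachLinnikAConstCertThree
import Literature.NumberTheory.Sieve.GoldbachLinnikGRH
import HarnessLib

/-!
# A kernel certificate for the singular-series mean constant `A(2)`, and the conditional GRH / EH frames with
their `A(k)` rows discharged by the tree's certificates

Topic `Literature/NumberTheory/Sieve`.  Companion of `GoldbachLinnikAConstCert.lean` (`A(4) ≤ 0.6602·(R₀ − 0.40425) − 1`)
and `GoldbachLinnikAConstCertThree.lean` (`A(3) ≤ 0.6602·(R₀ − 0.3932) − 1`) — reproduction cell
`papers/Parity/linnik-goldbach-7` (**NOT a route to Goldbach**; the published record `K = 8` is NOT lowered, `K = 7` is NOT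
claimed, nothing below is unconditional beyond the stated finite inequalities, nothing internal is cited as a fact).

* J. Pintz, I. Z. Ruzsa, *On Linnik's approximation to Goldbach's problem, I*, Acta Arith. 109 (2003) 169–194, §9: the
  constants `A(k) = C₀ ∑_d κ(d) P_d(k) − 1` ((9.4)–(9.7), Theorem 4, after Khalfalah–Pintz); (9.10) prints
  `0.0126 < A(3) < 0.0136`, `0.003 < A(4) < 0.004` and NO window for `A(2)`; (9.8): `A(k) > 2^{−2k−1}`.
  [PintzRuzsa2003]
* D. R. Johnston, T. S. Trudgian, *An update on the Linnik–Goldbach and Romanov problems*, arXiv:2605.17825: the fine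
  window `0.05458 < A(2) < 0.05549` quoted there from Khalfalah–Pintz 2006 (a source this cell could not read), used as
  the HYPOTHESIS `hA2le : A₂ ≤ 0.05549` of the tree's Elliott–Halberstam frame `goldbach_linnik_four_of_EH_inputs`
  (`GoldbachLinnikGRH.lean` §3). [JohnstonTrudgian2026]

What this file PROVES (no hypotheses unless named; standard axioms; the one new kernel fact is `decide +kernel`, no
`native_decide`):

* §1 `tsum_kappa_mul_residueProb_two_le : ∑' d, κ(d)P_d(2) ≤ R₀ − 0.330867` and
  `aConst_two_le_of_romanovConst_le : romanovConst ≤ R → aConst 2 ≤ 0.6602·(R − 0.330867) − 1` (= `0.06235` at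
  `R = 1.94`, `aConst_two_le_certR0`): the subset-lattice certificate of `GoldbachLinnikAConstCert` with exponent `j_q = 2`
  on EVERY one of its 465 moduli — NO NEW DATA: the kernel fact `sigma2_ok` only re-evaluates the Möbius sums of the
  landed, kernel-verified pair counts `N_q(2)` (it is `AConstCertThree.sigmaOK3` with the EMPTY third-moment list).
  Print comparison: Khalfalah–Pintz's `A(2) < 0.05549` (as quoted by Johnston–Trudgian) is sharper and is NOT reproduced;
  our `0.06235` is a weaker upper bound consistent with it — the first bound on `A(2)` in this cell that does not rest on
  an unread source.
* §2 the criterion inequalities of `GoldbachLinnikGRH.lean` re-certified on the CERTIFICATE boxes (`norm_num`):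
  `crit22_EH_certA_lt_one` (`A₂ ≤ 0.06235`: factor `< 0.98049`, print-window factor `< 0.97358`),
  `crit33_GRH_certA_lt_one` (`A₃ ≤ 0.021197`: factor `< 0.87307`, print `≤ 0.865`),
  `crit43_GRH_certA_lt_one` (`A₃ ≤ 0.021197`, `A₄ ≤ 0.013902`: product `< 0.56956`, print `0.5551`).
* §3 the three conditional frames of `GoldbachLinnikGRH.lean` with their rows `hA2le/hA2nn/hA2`, `hA3le/hA3nn/hA3`,
  `hA4le/hA4nn/hA4` DISCHARGED by `hA_of_aConst` and the certificates (the Romanov row inside them by this cell's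
  `romanovConst_le_194`): `goldbach_linnik_four_of_EH_inputs_certA`, `goldbach_linnik_six_of_GRH_inputs_certA`,
  `goldbach_linnik_seven_of_GRH_inputs_certA`.  EVERY analytic input (all of GRH's / EH's work: `hM`, `hS`, `hEU`, `hG`,
  `hCi` with its boxed constant) remains a HYPOTHESIS exactly as in the parent frames; these theorems assert nothing about
  GRH, EH or the preprint constants `C* = 3.3907`, `C* = 2`.

NOT a route to Goldbach; `K = 7` NOT claimed; `K = 6` NOT obtained; the GRH/EH statements are conditional frames only.
-/

open Finset Filter MeasureTheory

namespace Literature.NumberTheory.Sieve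

namespace GoldbachLinnik

open SingularSeriesMean Literature.NumberTheory.Sieve.Romanov Literature.NumberTheory.Sieve.PintzRuzsa2003

namespace AConstCertTwo

open RomanovClass AConstCert AConstCertThree

/-! ## §1 The `A(2)` certificate from the landed pair counts -/

/-- The certified saving `σ₂⁰ = 0.330867` (the kernel value `Π_S · Σ_F s_q(2)/φ(q)² = 0.3308679…` rounded down).
[folklore] -/
def sigma2 : ℚ := 330867 / 1000000

set_option maxRecDepth 8192 in
set_option maxHeartbeats 400000000 in
/-- KERNEL FACT: with the empty third-moment list (exponent `2` on every modulus) all sub-product values are present and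
`σ₂⁰ ≤ Π_S · Σ_F s_q(2)/φ(q)²` in exact rational arithmetic. [folklore] -/
theorem sigma2_ok : sigmaOK3 [] sigma2 = true := by decide +kernel

/-- With the empty list every exponent is `2`. [folklore] -/
theorem jOf3_nil (en : ℕ × List ℕ × ℕ × ℕ × ℕ) : jOf3 [] en = 2 := by
  simp [jOf3, findEnt3]

/-- The two global checks of `sigmaOK3 []`. [folklore] -/
theorem sigmaOK2_sound : (∀ en ∈ tab, hasAll3 [] 2 en.2.1 = true) ∧ sigma2 ≤ piS Slist * sumFQ3 [] := by
  have h := sigma2_ok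
  simp only [sigmaOK3, Bool.and_eq_true, decide_eq_true_eq, List.all_eq_true, jOf3_nil] at h
  exact ⟨h.1, h.2⟩

/-- A table value with the empty list and exponent `2` is the pair deficiency `D_d(2)`. [folklore] -/
theorem tval2_sound {d : ℕ} {v : ℚ} (h : tval3 [] 2 d = some v) : (v : ℝ) = Ddef d 2 := by
  have h' : tval tab 2 d = some v := by simpa [tval3] using h
  exact tval_sound (Or.inl rfl) h'

/-- **The kernel's Möbius sum is `s_U(2)`** for every table entry. [folklore] -/
theorem svalQ2_sound {en : ℕ × List ℕ × ℕ × ℕ × ℕ} (hmem : en ∈ tab) :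
    ((svalQ3 [] 2 en.2.1 : ℚ) : ℝ) = sdef en.2.1.toFinset 2 := by
  obtain ⟨hnd, hpr, -, -, -, -⟩ := entry_props hmem
  set U := en.2.1 with hUdef
  have hcnt : (((subl U).map fun U' => if U'.length = 0 then 0 else
      if (tval3 [] 2 U'.prod).isSome then 0 else 1).sum) = 0 := by
    have h := sigmaOK2_sound.1 en hmem
    rw [hasAll3] at h
    simpa using h
  have hcnt' : ∑ V ∈ U.toFinset.powerset, (fun (_ : Finset ℕ) (c π : ℕ) => if c = 0 then 0 else
      if (tval3 [] 2 π).isSome then 0 else 1) V V.card (∏ p ∈ V, p) = 0 := by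
    rw [← subl_sum_eq U hnd (fun (_ : Finset ℕ) (c π : ℕ) => if c = 0 then 0 else
      if (tval3 [] 2 π).isSome then 0 else 1)]
    exact hcnt
  have hsome : ∀ V ∈ U.toFinset.powerset, V ≠ ∅ → ((tval3 [] 2 (∏ p ∈ V, p)).isSome : Prop) := by
    intro V hV hne
    have h0 := Finset.sum_eq_zero_iff.1 hcnt' V hV
    have hc : V.card ≠ 0 := fun hc => hne (Finset.card_eq_zero.1 hc)
    simp only [if_neg hc] at h0
    by_contra hns
    rw [if_neg hns] at h0
    exact one_ne_zero h0
  have hφ : svalQ3 [] 2 U = ∑ V ∈ U.toFinset.powerset, (fun (_ : Finset ℕ) (c π : ℕ) =>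
      if c = 0 then (0 : ℚ) else (if (U.length - c) % 2 = 0 then 1 else -1) * (tval3 [] 2 π).getD 0)
        V V.card (∏ p ∈ V, p) := by
    rw [svalQ3]
    exact subl_sum_eq U hnd (fun (_ : Finset ℕ) (c π : ℕ) =>
      if c = 0 then (0 : ℚ) else (if (U.length - c) % 2 = 0 then 1 else -1) * (tval3 [] 2 π).getD 0)
  rw [hφ, sdef_eq_moebius hpr, Rat.cast_sum]
  refine Finset.sum_congr rfl fun V hV => ?_
  by_cases hV0 : V = ∅
  · subst hV0
    simp [setProd, Ddef_one]
  · have hc : V.card ≠ 0 := fun hc => hV0 (Finset.card_eq_zero.1 hc)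
    obtain ⟨v, hv⟩ := Option.isSome_iff_exists.1 (hsome V hV hV0)
    simp only [if_neg hc, hv, Option.getD_some]
    rw [← neg_one_pow_eq_sign, List.toFinset_card_of_nodup hnd]
    push_cast
    rw [tval2_sound hv, setProd]

/-- **The kernel sum `Σ_F` in real terms** (exponent `2` throughout). [folklore] -/
theorem sumFQ2_eq : ((sumFQ3 [] : ℚ) : ℝ) =
    ∑ en ∈ tab.toFinset, sdef en.2.1.toFinset 2 / (∏ p ∈ en.2.1.toFinset, ((p : ℝ) - 1)) ^ 2 := by
  rw [sumFQ3, ← List.sum_toFinset _ tab_nodup, Rat.cast_sum]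
  refine Finset.sum_congr rfl fun en hen => ?_
  have hmem : en ∈ tab := List.mem_toFinset.1 hen
  obtain ⟨hnd, -, -, -, -, -⟩ := entry_props hmem
  rw [jOf3_nil, Rat.cast_div, Rat.cast_pow, svalQ2_sound hmem, Rat.cast_list_prod, List.map_map,
    ← List.prod_toFinset _ hnd]
  congr 2
  refine Finset.prod_congr rfl fun p _ => ?_
  simp

/-- **The certified saving**: `σ₂⁰ ≤ Π_S · ∑_{q∈F} s_q(2)/φ(q)²`. [folklore] -/
theorem sigma2_le : ((sigma2 : ℚ) : ℝ) ≤ (∏ p ∈ Slist.toFinset, (1 + 1 / ((p : ℝ) * ((p : ℝ) - 2)))) *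
    ∑ en ∈ tab.toFinset, sdef en.2.1.toFinset 2 / (∏ p ∈ en.2.1.toFinset, ((p : ℝ) - 1)) ^ 2 := by
  rw [← piS_eq, ← sumFQ2_eq, ← Rat.cast_mul]
  exact Rat.cast_le.2 sigmaOK2_sound.2

/-- **Main theorem, series form**: `∑'_d κ(d)P_d(2) ≤ R₀ − 0.330867` (`R₀ = romanovConstPR = romanovConst`).
[cite: PintzRuzsa2003, §9 Theorem 4 (9.4)–(9.7)] -/
theorem tsum_kappa_mul_residueProb_two_le :
    ∑' d : ℕ, kappa d * residueProb d 2 ≤ romanovConstPR - 330867 / 1000000 := by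
  have hS : ∀ p ∈ Slist.toFinset, p.Prime ∧ Odd p := fun p hp => prime_odd_of_mem_Slist (List.mem_toFinset.1 hp)
  have hF : ∀ en ∈ tab.toFinset, en.2.1.toFinset ⊆ Slist.toFinset := fun en hen p hp => by
    obtain ⟨-, -, -, hU, -⟩ := entOK_sound (entOK_of_mem (List.mem_toFinset.1 hen))
    exact List.mem_toFinset.2 (hU p (List.mem_toFinset.1 hp))
  have hinj : Set.InjOn (fun en : ℕ × List ℕ × ℕ × ℕ × ℕ => en.2.1.toFinset) (tab.toFinset : Finset _) := by
    intro en hen en' hen' h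
    have hm : en ∈ tab := List.mem_toFinset.1 hen
    have hm' : en' ∈ tab := List.mem_toFinset.1 hen'
    obtain ⟨-, -, hq, -⟩ := entry_props hm
    obtain ⟨-, -, hq', -⟩ := entry_props hm'
    refine tab_key_inj hm hm' ?_
    simp only at h
    rw [hq, hq', h]
  have hj : ∀ en ∈ tab.toFinset, 1 ≤ (fun _ : ℕ × List ℕ × ℕ × ℕ × ℕ => 2) en ∧
      (fun _ : ℕ × List ℕ × ℕ × ℕ × ℕ => 2) en ≤ 2 := fun _ _ => by simp
  have h := tsum_kappa_mul_residueProb_le_cert (k := 2) (by norm_num) hS tab.toFinset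
    (fun en => en.2.1.toFinset) hF hinj (fun _ => 2) hj
  have hσ := sigma2_le
  have hσ0 : ((sigma2 : ℚ) : ℝ) = 330867 / 1000000 := by rw [sigma2]; norm_num
  linarith

/-- **Main theorem**: `A(2) ≤ 0.6602·(R − 0.330867) − 1` for every `R ≥ R₀ = romanovConst`; in particular
`A(2) ≤ 0.06235` if `R₀ ≤ 1.94` (print: NO window for `A(2)` in Pintz–Ruzsa I (9.10); Khalfalah–Pintz 2006 as quoted by
Johnston–Trudgian: `0.05458 < A(2) < 0.05549` — sharper, NOT reproduced here; this certificate is a weaker upper bound,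
consistent with it). [cite: PintzRuzsa2003, (8.14), (8.16), §9 Theorem 4 (9.7)] -/
theorem aConst_two_le_of_romanovConst_le {R : ℝ} (hR : romanovConst ≤ R) :
    PintzRuzsa2003.aConst 2 ≤ 0.6602 * (R - 330867 / 1000000) - 1 := by
  have h := tsum_kappa_mul_residueProb_two_le
  rw [← romanovConst_eq_romanovConstPR] at h
  have hC0 : (0 : ℝ) ≤ twinPrimeConst := le_trans (by norm_num) half_le_twinPrimeConst
  have hC : twinPrimeConst ≤ 0.6602 := twinPrimeConst_le_06602
  have hS0 : 0 ≤ ∑' d : ℕ, kappa d * residueProb d 2 :=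
    tsum_nonneg fun d => mul_nonneg (kappa_nonneg d) (residueProb_nonneg d 2)
  unfold PintzRuzsa2003.aConst
  nlinarith [mul_le_mul hC h hS0 (by norm_num : (0 : ℝ) ≤ 0.6602)]

/-- `A(2) ≤ 0.06235` from the Romanov certificate `R₀ ≤ 1.94` of this cell (`romanovConst_le_194`).
[cite: PintzRuzsa2003, §9 Theorem 4 (9.7), (8.14)] -/
theorem aConst_two_le_certR0 : PintzRuzsa2003.aConst 2 ≤ 0.6602 * (1.94 - 330867 / 1000000) - 1 :=
  aConst_two_le_of_romanovConst_le romanovConst_le_194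

/-! ## §2 The GRH / EH criterion inequalities on the certificate boxes -/

/-- **(2,2) criterion under Elliott–Halberstam on the certificate box**: `A₂ ≤ 0.6602·(1.94 − 0.330867) − 1 = 0.06235`,
`C ≤ C₀R₀(2 − 1) + (5/9 + 10⁻⁴)(log 2)/2`, `C₀R₀ ≤ 1.280714`, `λ ≤ 0.789401`: factor `A₂ + Cλ² < 0.98049 < 1`
(with Khalfalah–Pintz's window: `< 0.97358`, `crit22_EH_lt_one`). [cite: JohnstonTrudgian2026, Theorem EHthm] -/
theorem crit22_EH_certA_lt_one {A₂ C C0R0 lam : ℝ} (hA2le : A₂ ≤ 0.6602 * (1.94 - 330867 / 1000000) - 1)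
    (hA2nn : 0 ≤ A₂) (hCR : C0R0 ≤ 1.280714)
    (hCle : C ≤ C0R0 * ((2 : ℝ) - 1) + Real.log 2 / 2 * (5 / 9 + 1 / 10 ^ 4)) (hCnn : 0 ≤ C)
    (hlamle : lam ≤ 0.789401) (hlamnn : 0 ≤ lam) :
    (A₂ + C * lam ^ (2 * 2 - 2)) * (A₂ + C * lam ^ (2 * 2 - 2)) < 1 := by
  have hl : Real.log 2 < 0.6931471808 := Real.log_two_lt_d9
  have hCle' : C ≤ 1.47329 := by nlinarith
  have hl2 : lam ^ 2 ≤ (0.789401 : ℝ) ^ 2 := pow_le_pow_left₀ hlamnn hlamle 2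
  have hCl : C * lam ^ 2 ≤ (1.47329 : ℝ) * 0.789401 ^ 2 :=
    mul_le_mul hCle' hl2 (by positivity) (by norm_num)
  have hval : A₂ + C * lam ^ 2 < 1 := by
    have : (0.6602 * (1.94 - 330867 / 1000000) - 1 : ℝ) + (1.47329 : ℝ) * 0.789401 ^ 2 < 0.98049 := by norm_num
    linarith
  have hnn : 0 ≤ A₂ + C * lam ^ 2 := by positivity
  have h2 : (2 * 2 - 2 : ℕ) = 2 := by norm_num
  rw [h2]
  exact mul_lt_one_of_nonneg_of_lt_one_left hnn hval hval.le

/-- **(3,3) criterion under GRH on the certificate box**: `A₃ ≤ 0.6602·(1.94 − 0.3932) − 1 = 0.021197`,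
`C ≤ C₀R₀(3.3907 − 1) + (log 2)/4`, `C₀R₀ ≤ 1.280714`, `λ ≤ 0.7163436`: factor `A₃ + Cλ⁴ < 0.87307 < 1`
(with `A₃ ≤ 0.0136`: `< 0.86547`, `crit33_GRH_lt_one`; print `≤ 0.865`). [cite: JohnstonTrudgian2026, Theorem 1.1 (GRHGoldLin), proof] -/
theorem crit33_GRH_certA_lt_one {A₃ C C0R0 lam : ℝ} (hA3le : A₃ ≤ 0.6602 * (1.94 - 983 / 2500) - 1) (hA3nn : 0 ≤ A₃)
    (hCR : C0R0 ≤ 1.280714) (hCle : C ≤ C0R0 * ((3.3907 : ℝ) - 1) + Real.log 2 / 4) (hCnn : 0 ≤ C)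
    (hlamle : lam ≤ 0.7163436) (hlamnn : 0 ≤ lam) :
    (A₃ + C * lam ^ (2 * 3 - 2)) * (A₃ + C * lam ^ (2 * 3 - 2)) < 1 := by
  have hl : Real.log 2 < 0.6931471808 := Real.log_two_lt_d9
  have hCle' : C ≤ 3.23509 := by nlinarith
  have hl4 : lam ^ 4 ≤ (0.7163436 : ℝ) ^ 4 := pow_le_pow_left₀ hlamnn hlamle 4
  have hCl : C * lam ^ 4 ≤ (3.23509 : ℝ) * 0.7163436 ^ 4 :=
    mul_le_mul hCle' hl4 (by positivity) (by norm_num)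
  have hval : A₃ + C * lam ^ 4 < 1 := by
    have : (0.6602 * (1.94 - 983 / 2500) - 1 : ℝ) + (3.23509 : ℝ) * 0.7163436 ^ 4 < 0.87307 := by norm_num
    linarith
  have hnn : 0 ≤ A₃ + C * lam ^ 4 := by positivity
  have h4 : (2 * 3 - 2 : ℕ) = 4 := by norm_num
  rw [h4]
  exact mul_lt_one_of_nonneg_of_lt_one_left hnn hval hval.le

/-- The GRH `(4,3)` corner on the certificate box:
`(0.013902… + C·0.7163436⁶)(0.021197… + C·0.7163436⁴) = 0.5695… < 1` at
`C = 1.280714·(3.9171 − 1) + 0.6931471808/4`. [cite: PintzRuzsa2003, Lemma 13 (10.2) and (10.15)] -/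
theorem crit43_GRH_certA_corner_lt_one :
    ((0.6602 * (1.94 - 1617 / 4000) - 1 : ℝ) + (1.280714 * ((3.9171 : ℝ) - 1) + 0.6931471808 / 4) * 0.7163436 ^ (2 * 4 - 2)) *
      ((0.6602 * (1.94 - 983 / 2500) - 1 : ℝ) + (1.280714 * ((3.9171 : ℝ) - 1) + 0.6931471808 / 4) * 0.7163436 ^ (2 * 3 - 2))
      < 1 := by
  norm_num

/-- **(4,3) criterion under GRH on the certificate box**: `A₃ ≤ 0.021197`, `A₄ ≤ 0.013902` (this cell's certificates at
`R₀ ≤ 1.94`), `C ≤ C₀R₀(3.9171 − 1) + (log 2)/4` (Chen), `C₀R₀ ≤ 1.280714`, `λ ≤ 0.7163436`: product `< 0.5696 < 1`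
(print-window box: `< 0.5552`, `crit43_GRH_lt_one`). [cite: PintzRuzsa2003, Lemma 11 (8.22), Lemma 13 (10.2), (10.14)–(10.15)] -/
theorem crit43_GRH_certA_lt_one {A₃ A₄ C C0R0 lam : ℝ} (hA3le : A₃ ≤ 0.6602 * (1.94 - 983 / 2500) - 1)
    (hA3nn : 0 ≤ A₃) (hA4le : A₄ ≤ 0.6602 * (1.94 - 1617 / 4000) - 1) (hA4nn : 0 ≤ A₄) (hCR : C0R0 ≤ 1.280714)
    (hCle : C ≤ C0R0 * ((3.9171 : ℝ) - 1) + Real.log 2 / 4) (hCnn : 0 ≤ C)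
    (hlamle : lam ≤ 0.7163436) (hlamnn : 0 ≤ lam) :
    (A₄ + C * lam ^ (2 * 4 - 2)) * (A₃ + C * lam ^ (2 * 3 - 2)) < 1 := by
  have hl : Real.log 2 < 0.6931471808 := Real.log_two_lt_d9
  have hC' : C ≤ 1.280714 * ((3.9171 : ℝ) - 1) + 0.6931471808 / 4 := by nlinarith
  have h6 : lam ^ (2 * 4 - 2) ≤ 0.7163436 ^ (2 * 4 - 2) := pow_le_pow_left₀ hlamnn hlamle _
  have h4 : lam ^ (2 * 3 - 2) ≤ 0.7163436 ^ (2 * 3 - 2) := pow_le_pow_left₀ hlamnn hlamle _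
  have h6₀ : 0 ≤ lam ^ (2 * 4 - 2) := by positivity
  have h4₀ : 0 ≤ lam ^ (2 * 3 - 2) := by positivity
  have hK₀ : (0 : ℝ) ≤ 1.280714 * ((3.9171 : ℝ) - 1) + 0.6931471808 / 4 := by norm_num
  have hA : A₄ + C * lam ^ (2 * 4 - 2)
      ≤ (0.6602 * (1.94 - 1617 / 4000) - 1 : ℝ) +
        (1.280714 * ((3.9171 : ℝ) - 1) + 0.6931471808 / 4) * 0.7163436 ^ (2 * 4 - 2) := by
    nlinarith [mul_le_mul hC' h6 h6₀ hK₀]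
  have hB : A₃ + C * lam ^ (2 * 3 - 2)
      ≤ (0.6602 * (1.94 - 983 / 2500) - 1 : ℝ) +
        (1.280714 * ((3.9171 : ℝ) - 1) + 0.6931471808 / 4) * 0.7163436 ^ (2 * 3 - 2) := by
    nlinarith [mul_le_mul hC' h4 h4₀ hK₀]
  have hA₀ : 0 ≤ A₄ + C * lam ^ (2 * 4 - 2) := by positivity
  have hB₀ : 0 ≤ A₃ + C * lam ^ (2 * 3 - 2) := by positivity
  exact (mul_le_mul hA hB hB₀ (by positivity)).trans_lt crit43_GRH_certA_corner_lt_one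

/-! ## §3 The conditional GRH / EH frames with the `A(k)` rows discharged by the certificates -/

/-- **`K = 4` under Elliott–Halberstam, `A(2)` row by certificate.**  `goldbach_linnik_four_of_EH_inputs`
(`GoldbachLinnikGRH.lean` §3, after Johnston–Trudgian, Theorem EHthm) with `A₂ := max (aConst 2) 0`, its row `hA2`
supplied by Theorem 4 of the tree (`hA_of_aConst`) and its box `A₂ ≤ 0.05549` (Khalfalah–Pintz, unread here) REPLACED by
the kernel certificate `aConst_two_le_certR0` (`≤ 0.06235`; criterion factor `< 0.98049`).  Every analytic input — the
EH pair-sieve constant `C* = 2` inside `hCi`/`hCle`, `hM`, `hS`, `hEU`, `hG` (`λ ≤ 0.789401`) — remains a HYPOTHESIS;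
nothing is asserted about EH. NOT a route to Goldbach. [cite: JohnstonTrudgian2026, Theorem EHthm and Theorem PRthm] -/
theorem goldbach_linnik_four_of_EH_inputs_certA {𝔐 E : ℕ → Set ℝ}
    (h𝔐 : ∀ N, MeasurableSet (𝔐 N)) (hE : ∀ N, MeasurableSet (E N)) {U : ℕ → ℝ}
    {C C0R0 lam Cerr : ℝ}
    (hCR : C0R0 ≤ 1.280714) (hCle : C ≤ C0R0 * ((2 : ℝ) - 1) + Real.log 2 / 2 * (5 / 9 + 1 / 10 ^ 4))
    (hCnn : 0 ≤ C) (hlamle : lam ≤ 0.789401) (hlamnn : 0 ≤ lam)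
    (hM : ∀ᶠ N : ℕ in atTop, ∀ m : ℤ, m ≠ 0 → Even m →
      majorArcPairIntegral (𝔐 N) N m ≤
        goldbachSingularSeries m.natAbs * N / Real.log N ^ 2 + Cerr * N / Real.log N ^ 3)
    (hS : ∀ᶠ N : ℕ in atTop, ∀ α ∈ Set.Icc (0 : ℝ) 1 \ 𝔐 N, ‖primeSum N α‖ ≤ U N)
    (hEU : ∀ ε : ℝ, 0 < ε → ∀ᶠ N : ℕ in atTop,
      (volume (E N ∩ Set.Icc (0 : ℝ) 1)).toReal * U N ^ 2 ≤ ε * N / Real.log N ^ 2)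
    (hG : ∀ᶠ N : ℕ in atTop, ∀ α ∈ Set.Icc (0 : ℝ) 1 \ E N, ‖powSum N α‖ ≤ lam * powLen N)
    (hCi : ∀ ε : ℝ, 0 < ε → ∀ᶠ N : ℕ in atTop,
      ∫ α in Set.Icc (0 : ℝ) 1 \ 𝔐 N, ‖primeSum N α * powSum N α‖ ^ 2 ≤
        (C + ε) * (2 * N * (powLen N : ℝ) ^ 2 / Real.log N ^ 2)) :
    goldbach_linnik_with 4 :=
  have hA2le : max (PintzRuzsa2003.aConst 2) 0 ≤ 0.6602 * (1.94 - 330867 / 1000000) - 1 :=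
    max_le aConst_two_le_certR0 (by norm_num)
  goldbach_linnik_with_of_analytic_inputs (i := 2) (j := 2) (by norm_num) (by norm_num) h𝔐 hE
    (le_max_right _ _) (le_max_right _ _) hCnn hlamnn
    (crit22_EH_certA_lt_one hA2le (le_max_right _ _) hCR hCle hCnn hlamle hlamnn) hM
    (hA_of_aConst (k := 2) (by norm_num)) (hA_of_aConst (k := 2) (by norm_num)) hS hEU hG hCi

/-- **`K = 6` under GRH (Johnston–Trudgian, Theorem 1.1), `A(3)` row by certificate.**  `goldbach_linnik_six_of_GRH_inputs`
(`GoldbachLinnikGRH.lean` §2) with `A₃ := max (aConst 3) 0` (`hA_of_aConst`) and its box `A₃ ≤ 0.0136` ((9.10)) REPLACED by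
the kernel certificate `AConstCertThree.aConst_three_le_certR0` (`≤ 0.021197`; factor `< 0.87307`).  Every analytic input
— GRH's arcs `hM`, `hS`, `hEU`, `hG` (`λ ≤ 0.7163436`), and `hCi`/`hCle` with the PREPRINT pair-sieve constant
`C* = 3.3907` — remains a HYPOTHESIS; nothing is asserted about GRH or the preprints. NOT a route to Goldbach; `K = 6` is
NOT obtained by this cell. [cite: JohnstonTrudgian2026, Theorem 1.1 (GRHGoldLin) and Theorem PRthm] -/
theorem goldbach_linnik_six_of_GRH_inputs_certA {𝔐 E : ℕ → Set ℝ}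
    (h𝔐 : ∀ N, MeasurableSet (𝔐 N)) (hE : ∀ N, MeasurableSet (E N)) {U : ℕ → ℝ}
    {C C0R0 lam Cerr : ℝ}
    (hCR : C0R0 ≤ 1.280714) (hCle : C ≤ C0R0 * ((3.3907 : ℝ) - 1) + Real.log 2 / 4)
    (hCnn : 0 ≤ C) (hlamle : lam ≤ 0.7163436) (hlamnn : 0 ≤ lam)
    (hM : ∀ᶠ N : ℕ in atTop, ∀ m : ℤ, m ≠ 0 → Even m →
      majorArcPairIntegral (𝔐 N) N m ≤
        goldbachSingularSeries m.natAbs * N / Real.log N ^ 2 + Cerr * N / Real.log N ^ 3)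
    (hS : ∀ᶠ N : ℕ in atTop, ∀ α ∈ Set.Icc (0 : ℝ) 1 \ 𝔐 N, ‖primeSum N α‖ ≤ U N)
    (hEU : ∀ ε : ℝ, 0 < ε → ∀ᶠ N : ℕ in atTop,
      (volume (E N ∩ Set.Icc (0 : ℝ) 1)).toReal * U N ^ 2 ≤ ε * N / Real.log N ^ 2)
    (hG : ∀ᶠ N : ℕ in atTop, ∀ α ∈ Set.Icc (0 : ℝ) 1 \ E N, ‖powSum N α‖ ≤ lam * powLen N)
    (hCi : ∀ ε : ℝ, 0 < ε → ∀ᶠ N : ℕ in atTop,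
      ∫ α in Set.Icc (0 : ℝ) 1 \ 𝔐 N, ‖primeSum N α * powSum N α‖ ^ 2 ≤
        (C + ε) * (2 * N * (powLen N : ℝ) ^ 2 / Real.log N ^ 2)) :
    goldbach_linnik_with 6 :=
  have hA3le : max (PintzRuzsa2003.aConst 3) 0 ≤ 0.6602 * (1.94 - 983 / 2500) - 1 :=
    max_le aConst_three_le_certR0 (by norm_num)
  goldbach_linnik_with_of_analytic_inputs (i := 3) (j := 3) (by norm_num) (by norm_num) h𝔐 hE
    (le_max_right _ _) (le_max_right _ _) hCnn hlamnn
    (crit33_GRH_certA_lt_one hA3le (le_max_right _ _) hCR hCle hCnn hlamle hlamnn) hM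
    (hA_of_aConst (k := 3) (by norm_num)) (hA_of_aConst (k := 3) (by norm_num)) hS hEU hG hCi

/-- **`K = 7` under GRH (Pintz–Ruzsa I, Theorem 1; Heath-Brown–Puchta), `A(3)`, `A(4)` rows by certificate.**
`goldbach_linnik_seven_of_GRH_inputs` (`GoldbachLinnikGRH.lean` §1) with `A₃ := max (aConst 3) 0`, `A₄ := max (aConst 4) 0`
(`hA_of_aConst`) and the boxes `A₃ ≤ 0.0136`, `A₄ ≤ 0.004` ((9.10)) REPLACED by the kernel certificates
(`≤ 0.021197`, `≤ 0.013902`; product `< 0.5696`).  Every analytic input — GRH's `hM`, `hS`, `hEU`, `hG`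
(`λ ≤ 0.7163436`), `hCi`/`hCle` with Chen's `C* = 3.9171` — remains a HYPOTHESIS; nothing is asserted about GRH.
NOT a route to Goldbach; `K = 7` is NOT claimed. [cite: PintzRuzsa2003, Theorem 1, §10 (10.10)–(10.16), Lemmas 11–13] -/
theorem goldbach_linnik_seven_of_GRH_inputs_certA {𝔐 E : ℕ → Set ℝ}
    (h𝔐 : ∀ N, MeasurableSet (𝔐 N)) (hE : ∀ N, MeasurableSet (E N)) {U : ℕ → ℝ}
    {C C0R0 lam Cerr : ℝ} (hCR : C0R0 ≤ 1.280714)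
    (hCle : C ≤ C0R0 * ((3.9171 : ℝ) - 1) + Real.log 2 / 4)
    (hCnn : 0 ≤ C) (hlamle : lam ≤ 0.7163436) (hlamnn : 0 ≤ lam)
    (hM : ∀ᶠ N : ℕ in atTop, ∀ m : ℤ, m ≠ 0 → Even m →
      majorArcPairIntegral (𝔐 N) N m ≤
        goldbachSingularSeries m.natAbs * N / Real.log N ^ 2 + Cerr * N / Real.log N ^ 3)
    (hS : ∀ᶠ N : ℕ in atTop, ∀ α ∈ Set.Icc (0 : ℝ) 1 \ 𝔐 N, ‖primeSum N α‖ ≤ U N)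
    (hEU : ∀ ε : ℝ, 0 < ε → ∀ᶠ N : ℕ in atTop,
      (volume (E N ∩ Set.Icc (0 : ℝ) 1)).toReal * U N ^ 2 ≤ ε * N / Real.log N ^ 2)
    (hG : ∀ᶠ N : ℕ in atTop, ∀ α ∈ Set.Icc (0 : ℝ) 1 \ E N, ‖powSum N α‖ ≤ lam * powLen N)
    (hCi : ∀ ε : ℝ, 0 < ε → ∀ᶠ N : ℕ in atTop,
      ∫ α in Set.Icc (0 : ℝ) 1 \ 𝔐 N, ‖primeSum N α * powSum N α‖ ^ 2 ≤
        (C + ε) * (2 * N * (powLen N : ℝ) ^ 2 / Real.log N ^ 2)) :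
    goldbach_linnik_with 7 :=
  have hA3le : max (PintzRuzsa2003.aConst 3) 0 ≤ 0.6602 * (1.94 - 983 / 2500) - 1 :=
    max_le aConst_three_le_certR0 (by norm_num)
  have hA4le : max (PintzRuzsa2003.aConst 4) 0 ≤ 0.6602 * (1.94 - 1617 / 4000) - 1 :=
    max_le aConst_four_le_certR0 (by norm_num)
  goldbach_linnik_with_of_analytic_inputs (i := 4) (j := 3) (by norm_num) (by norm_num) h𝔐 hE
    (le_max_right _ _) (le_max_right _ _) hCnn hlamnn
    (crit43_GRH_certA_lt_one hA3le (le_max_right _ _) hA4le (le_max_right _ _) hCR hCle hCnn hlamle hlamnn) hM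
    (hA_of_aConst (k := 4) (by norm_num)) (hA_of_aConst (k := 3) (by norm_num)) hS hEU hG hCi

end AConstCertTwo

end GoldbachLinnik

end Literature.NumberTheory.Sieve
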